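import Mathlib

/-!
# SoloBlindResplit — kernel anchor for LieExponent §3.26 (re-splitting; Corollary 13.2″)

Door L (Lie-group TPP submanifold triples).  Over a SUBGROUP pair `(H₂, H₃)` with `H₂ ∩ H₃ = 1` a
subset `M` is a third member of a TPP triple iff `M M⁻¹ ∩ H₃H₂ = {1}` (Lemma 3.1 of the solo-blind
paper).  Lemma 3.26 observes that for `H₂ = T_A N_A`, `H₃ = T_B N_B` with `T_B T_A = T_B' T_A'` and the
tori normalising their unipotent parts, the forbidden set `H₃H₂ = N_B (T_B T_A) N_A` sees the torus
only as a whole, so every presentation-dependent TPP obstruction (in particular Theorem 13(iv): a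
normalising torus element acting non-scalarly on the pencil) may be taken from ANY admissible
re-splitting.  Corollary 13.2″ then kills every T-split Borel-type codimension-2 pair of `GL₄(ℝ)`:
type `(1,3)` has no isotypic stratum because no third positive root of `A₃` agrees with a coinciding
pair `{α, β}` on `ker (α − β)`, and type `(2,2)` dies by the grading element `h = diag(3,1,-1,-3)`,
which lies in every character normaliser and acts on the pencil with eigenvalues `-2 ≠ 2`.

Recorded here (all elementary, the load-bearing finite algebra of the pen-proof):
* the set-product identity of Lemma 3.26 and the resulting equality of third-member conditions;
* the `A₃` check: for all ordered triples of distinct positive roots `(α, β, γ)` some `2 × 2` minor of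
  `(γ − α ; α − β)` is non-zero (so `γ − α ∉ ℝ(α − β)`), by `decide` over `ℤ`, together with the
  field-level lemma that a non-zero minor obstructs parallelism;
* the grading-element facts: every simple root takes the value `2` on `h`, every positive root the
  value `2 · height`, and `-2 ≠ 2`.
-/

set_option linter.dupNamespace false

namespace Summit.MatrixMultiplication.MatrixMultiplication.Theorems

open Pointwise

section Resplit

variable {G : Type*} [Group G]

/-- Lemma 3.26 (re-splitting): if `T_B` normalises `N_B` (as sets: `T_B N_B = N_B T_B`) for both
splittings and the torus products agree, `T_B T_A = T_B' T_A'`, then the forbidden sets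
`H₃H₂ = (T_B N_B)(T_A N_A)` of the two presentations coincide. -/
theorem soloLie_resplit_product (TA TB TA' TB' NA NB : Set G)
    (hB : TB * NB = NB * TB) (hB' : TB' * NB = NB * TB') (hT : TB * TA = TB' * TA') :
    (TB * NB) * (TA * NA) = (TB' * NB) * (TA' * NA) := by
  calc (TB * NB) * (TA * NA) = (NB * TB) * (TA * NA) := by rw [hB]
    _ = NB * ((TB * TA) * NA) := by simp only [mul_assoc]
    _ = NB * ((TB' * TA') * NA) := by rw [hT]
    _ = (NB * TB') * (TA' * NA) := by simp only [mul_assoc]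
    _ = (TB' * NB) * (TA' * NA) := by rw [hB']

/-- Consequence (Lemma 3.26 with Lemma 3.1): the third-member condition `M M⁻¹ ∩ H₃H₂ ⊆ {1}`, written
pointwise, is the same for the two presentations. -/
theorem soloLie_resplit_third_member (TA TB TA' TB' NA NB M : Set G)
    (hB : TB * NB = NB * TB) (hB' : TB' * NB = NB * TB') (hT : TB * TA = TB' * TA') :
    (∀ m ∈ M, ∀ m' ∈ M, m' * m⁻¹ ∈ (TB * NB) * (TA * NA) → m = m') ↔
    (∀ m ∈ M, ∀ m' ∈ M, m' * m⁻¹ ∈ (TB' * NB) * (TA' * NA) → m = m') := by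
  rw [soloLie_resplit_product TA TB TA' TB' NA NB hB hB' hT]

end Resplit

section RootsA3

/-- The six positive roots of `A₃` as integer vectors `ε_i − ε_j` (`i < j`), in the order
`ε₁−ε₂, ε₂−ε₃, ε₃−ε₄, ε₁−ε₃, ε₂−ε₄, ε₁−ε₄`. -/
def soloLie_resplit_root : Fin 6 → Fin 4 → ℤ :=
  ![![1, -1, 0, 0], ![0, 1, -1, 0], ![0, 0, 1, -1], ![1, 0, -1, 0], ![0, 1, 0, -1], ![1, 0, 0, -1]]

/-- The `(i,j)` minor of the `2 × 4` matrix with rows `γ − α` and `α − β`. -/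
def soloLie_resplit_minor (a b g : Fin 6) (i j : Fin 4) : ℤ :=
  (soloLie_resplit_root g i - soloLie_resplit_root a i) *
      (soloLie_resplit_root a j - soloLie_resplit_root b j) -
    (soloLie_resplit_root g j - soloLie_resplit_root a j) *
      (soloLie_resplit_root a i - soloLie_resplit_root b i)

/-- Corollary 13.2″, type `(1,3)`, the finite core: for every ordered triple of DISTINCT positive roots
`(α, β, γ)` of `A₃` some `2 × 2` minor of `(γ − α ; α − β)` is non-zero.  Hence `γ − α ∉ ℝ(α − β)`:
no third positive root agrees with a coinciding pair `{α, β}` on the hyperplane `ker (α − β)`, the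
weight spaces of `𝔲⁺` under a 3-dimensional diagonal torus have dimension `≤ 2`, and a `𝔱_B`-stable
pencil plane never lies in one weight space of `𝔱' ⊇ 𝔱_B` unless it is `𝔤_α ⊕ 𝔤_β` itself. -/
theorem soloLie_resplit_A3_no_third_root :
    ∀ a b g : Fin 6, a ≠ b → g ≠ a → g ≠ b →
      ∃ i j : Fin 4, soloLie_resplit_minor a b g i j ≠ 0 := by
  decide

/-- A non-zero `2 × 2` minor obstructs parallelism over any field (used with the integer minors above
after casting). -/
theorem soloLie_resplit_minor_obstructs {K : Type*} [Field K] {n : ℕ} (u v : Fin n → K) (i j : Fin n)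
    (h : u i * v j - u j * v i ≠ 0) : ¬ ∃ c : K, u = c • v := by
  rintro ⟨c, rfl⟩
  apply h
  simp only [Pi.smul_apply, smul_eq_mul]
  ring

end RootsA3

section Grading

/-- The grading element `h = diag(3,1,-1,-3)` of `𝔤𝔩₄`. -/
def soloLie_resplit_h : Fin 4 → ℤ := ![3, 1, -1, -3]

/-- Every simple root `α_i = ε_i − ε_{i+1}` takes the value `2` on `h`; hence `h` lies in every
character normaliser `Z(s) = {y : α_i(y) = α_j(y), i, j ∈ s}` (Corollary 13.2″, type `(2,2)`). -/
theorem soloLie_resplit_h_simple :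
    ∀ i : Fin 3, soloLie_resplit_h (Fin.castSucc i) - soloLie_resplit_h (Fin.succ i) = 2 := by
  decide

/-- Every positive root takes the value `2 · height` on `h` (heights `1,1,1,2,2,3` in the order of
`soloLie_resplit_root`). -/
theorem soloLie_resplit_h_height :
    ∀ r : Fin 6,
      soloLie_resplit_root r 0 * soloLie_resplit_h 0 + soloLie_resplit_root r 1 * soloLie_resplit_h 1 +
          soloLie_resplit_root r 2 * soloLie_resplit_h 2 + soloLie_resplit_root r 3 * soloLie_resplit_h 3 =
        2 * (![1, 1, 1, 2, 2, 3] : Fin 6 → ℤ) r := by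
  decide

/-- The two weights of `h` on the pencil `Π = ℝ q_A ⊕ ℝ q_B` of a type-`(2,2)` pair are `−α_{s_A}(h) = -2`
and `+α_{s_B}(h) = 2`; they differ, so `h` acts NON-scalarly and Theorem 13(iv) (re-split form) applies. -/
theorem soloLie_resplit_h_nonscalar :
    ∀ i j : Fin 3,
      -(soloLie_resplit_h (Fin.castSucc i) - soloLie_resplit_h (Fin.succ i)) ≠
        soloLie_resplit_h (Fin.castSucc j) - soloLie_resplit_h (Fin.succ j) := by
  decide

/-- Counting tail of Corollary 13.2″ in `GL₄(ℝ)`: `d = 16`, Theorem 13(iv) gives `d₁ ≤ d/2 − 1 = 7`, and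
with `d₂ = d₃ = 7` the sum is `≤ 21 = F(GL₄(ℝ)) = 3·16/2 − 4/2 − 1`. -/
theorem soloLie_resplit_gl4_sum (d₁ : ℕ) (h : d₁ ≤ 16 / 2 - 1) : d₁ + 7 + 7 ≤ 3 * 16 / 2 - 4 / 2 - 1 := by
  omega

end Grading

end Summit.MatrixMultiplication.MatrixMultiplication.Theorems
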